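import Summits.ValiantsHypothesis.ValiantsHypothesis.Theorems.KPlusLogSqLawTropicalGradedWalkDomTGlue2
import Summits.ValiantsHypothesis.ValiantsHypothesis.Theorems.KPlusLogSqLawTropicalGradedWalkDomTGlue3
import Summits.ValiantsHypothesis.ValiantsHypothesis.Theorems.KPlusLogSqLawTropicalGradedWalkDomTGlue4

/-!
# Dominance of the top states (type T)

GRW-lite `K = 4` graded-walk family (census side of the tropical root law, all `m`):
dominance glue for the TOP states `(w, w, t)`, `t ≤ w < m` (`w ≥ 1`), of the design typed in
`KPlusLogSqLawTropicalGradedWalkDefs`.  The slack of every rival cell against the row potential `UT`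
(file `…PotT`) was certified family by family in `…DomT1` – `…DomT7`; the files `…DomTGlue1` – `…DomTGlue5`
dispatch an arbitrary rival `(a, b, l)` to its family (far rivals are first reduced to the best class of
their level by the generic lifts of `…GradedWalkLift`) and conclude `IsDominant` via `isDominant_of_scaledPotential`.

Honest framing: this is a census-side (lower-bound) construction — a quadratic family of
distinct optimal slopes for `TropRootLawAt (n+1) 4`.  It says nothing about `TropicalB` inside
its window and nothing about VP ≠ VNP.

Main result of this part: `isDominant_T` — every state `(w, w, t)` with `t ≤ w ≤ n`, `1 ≤ w`, is the unique optimal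
assignment at its slope `theta n w w t` for the weights `vv n`, degrees `dd n`.
-/

set_option linter.dupNamespace false
set_option autoImplicit false

namespace Summit.ValiantsHypothesis.ValiantsHypothesis.Theorems.LacunarySymmetroidMatrixDescartes.TropicalCensus

namespace GradedWalk

open Summit.ValiantsHypothesis.ValiantsHypothesis.Theorems.MatrixDescartes.Negative

variable (n : ℕ)

/-! ### the dominance theorem for the top states of the phases `w < m` -/

/-- **The top state `(w, w, t)`, `t ≤ w < m`, `w ≥ 1`, of the GRW-lite design is the unique optimum at its slope.** -/
theorem isDominant_T (w t : ℕ) (htw : t ≤ w) (hwn : w ≤ n) (hw0 : 1 ≤ w) :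
    IsDominant (dd n) (vv n) (ee n) (theta n w w t) (cterm n w w t) := by
  have hw1 : w ≤ n + 1 := by omega
  rw [theta_T n (show w < n + 1 by omega) t]
  unfold cterm
  rw [perm_T n w t]
  refine isDominant_of_scaledPotential (dd n) (vv n) (ee n) (thT n w t) (rot n w) (lam n w w t) 1 one_pos
    (fun a => UT n w t a)
    (fun b => (thT n w t * (dd n (lam n w w t b) : ℤ) - vv n (rot n w b) b (lam n w w t b)) - UT n w t (rot n w b)) ?_ ?_ ?_
  · -- presence of the intended incidences
    intro i
    rw [lam_T n w t]
    by_cases hi : (i : ℕ) < w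
    · have hr := rot_val_blk n hw1 i hi
      rw [if_neg (by omega)]
      have hlow : (i : ℕ) < ((rot n w i : Fin (n + 1)) : ℕ) := by rw [hr]; omega
      split_ifs
      · exact ee_lower_ne n hlow 3 (by decide)
      · exact ee_lower_ne n hlow 2 (by decide)
    · have hr := rot_val_wrap n hw1 i (by omega)
      rw [if_pos (by omega)]
      have hup : ((rot n w i : Fin (n + 1)) : ℕ) < (i : ℕ) := by rw [hr]; omega
      exact ee_upper_zero_ne n hup
  · -- tightness (by definition of the column potential)
    intro i; ring
  · -- slack
    intro a b l hp hne
    by_cases hwb : w ≤ (b : ℕ)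
    · exact slackT_wrapcol n w t htw hwn hw0 a b l hp hne hwb
    · have hbw : (b : ℕ) < w := Nat.lt_of_not_le hwb
      rcases Nat.lt_or_ge (a : ℕ) (b : ℕ) with hab | hab
      · rcases (show l = 0 ∨ l = 1 ∨ l = 2 ∨ l = 3 by fin_cases l <;> simp) with rfl | rfl | rfl | rfl
        · exact slackT_blk_wrap0 n w t htw hwn a b hbw hab
        · exact slackT_blk_wrap1 n w t htw hwn a b hbw hab
        · exact absurd (ee_upper_ge_two n hab 2 (by decide)) hp
        · exact absurd (ee_upper_ge_two n hab 3 (by decide)) hp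
      · rcases Nat.lt_or_ge (a : ℕ) ((b : ℕ) + (n + 1 - w)) with halt | hge
        · exact slackT_blk_up n w t htw hwn a b l hp hbw hab halt
        · exact slackT_blk_ge n w t htw hwn a b l hp hne hbw hge

end GradedWalk

end Summit.ValiantsHypothesis.ValiantsHypothesis.Theorems.LacunarySymmetroidMatrixDescartes.TropicalCensus
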